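import Summits.Ventures.LatticeQCDFlow.TrivializingMaps.StrongCouplingSpecificHeat
import Summits.Ventures.LatticeQCDFlow.TrivializingMaps.WilsonFisherZerosAnyGroup
import Literature.MathematicalPhysics.QuantumLattice.TorusWilsonGibbs

/-!
HONEST FRAMING: exact (Metropolis-corrected) sampling algorithms for lattice gauge theory; figures
of merit are autocorrelation/cost numbers at stated couplings and volumes; no continuum-physics
claim.

# SpecificHeatAnyGroup — THE SPECIFIC HEAT PER PLAQUETTE AT STRONG COUPLING IS `Var_Haar(Re tr ρ) +
# O(|x|)` UNIFORMLY IN THE VOLUME, FOR EVERY COMPACT GAUGE GROUP; `U(1)`: `½ + O(|x|)` AND A FISHER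
# ZERO WITHIN `16` OF EVERY STRONG-COUPLING POINT (lean-2 GEN-8, ours)

Venture-side (OURS).  Cell `lqcd-flow` (pub-lqcd), unit `pub-lqcd-lean-2-g8`, 2026-08-22.  The
every-compact-group version of `StrongCouplingSpecificHeat` (there: `SU(n)` through the ambient-action
dictionary).  Here the dictionary is Mathlib's cumulant generating function: for `G` compact second
countable and `ρ` continuous, `ψ := cgf(-S_W^ρ)` under `D[U]` is real-analytic on `ℝ`,
`ψ″(t) = Var_{μ_t}(S_W^ρ)` (`variance_tilted_mul` + the Literature's `wilsonMeasure_eq_tilted_pi`), and on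
the Kotecký–Preiss disc `|s| < r(d, N) = 1/(4e·max(1,2N)·(3^d d²+1)²)` of `WilsonZeroFreeKP` the holomorphic
logarithm `F` of the torus plaquette system (`exp F = Z_L`, `‖F‖ ≤ #plaq`) has `Re F = ψ` on the real
segment, so `Var_t = Re F″(t)` there and Cauchy's inequality applies:

* §1 `mem_interior_integrableExpSet_neg_wilsonAction`, `wilsonMeasure_eq_tilted_neg`,
  `iteratedDeriv_two_cgf_eq_variance_wilsonMeasure` — the dictionary;
* §2 `logZ_kp_package_anyGroup` — `F` holomorphic and `‖F‖ ≤ #plaq` on `|s| < r`, `Re F = ψ` on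
  `(-r, r)`; `variance_eq_re_iteratedDeriv_two` — `Var_t(S_W^ρ) = Re F″(t)` for `|t| < r`;
* §3 **`wilson_variance_sub_le_anyGroup`** — for every `L ≥ 2` and real `|x| < r/4`:
  `|Var_x(S_W^ρ) − #plaq·Var_Haar(Re tr ρ)| ≤ 256·#plaq·|x|/r³`; **`wilson_variance_le_anyGroup`** —
  `Var_x ≤ 32·#plaq/r²` for `|x| < r/2`, every `L`; **`wilson_exists_fisherZero_near_anyGroup`** — if
  `v_ρ = Var_Haar(Re tr ρ) > 0`, `d ≥ 2`, `L ≥ 2` and `|x| ≤ min (r/8) (v_ρ r³/512)`: a zero `s₀` of `Z_L`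
  with `|s₀ − x| ≤ 8N/v_ρ`;
* §4 **`U(1)`**: `|Var_x(S_W) − #plaq/2| ≤ 256·#plaq·|x|/r³` (`r = 1/(8e(3^d d²+1)²)`) and a Fisher zero
  within `16` of every real `x` with `|x| ≤ min (r/8) (r³/1024)`, every volume `L ≥ 2`, `d ≥ 2`.

NOT CLAIMED: anything at `|x| ≥ r/4`; sharpness of constants (`r` is astronomically small; the value is
structural); `L = 1`; cost / autocorrelation / continuum statements.  Literature grade (cell rule):
known mechanism ([OsterwalderSeilerAnnPhys1978] Thm. 3.7, [KoteckyPreiss1986]; Cauchy estimates); new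
typing, no new theorem of physics.
-/

noncomputable section

open MeasureTheory ProbabilityTheory Complex Metric Set Filter Topology
open Literature.MathematicalPhysics.QuantumFieldTheory
open Literature.MathematicalPhysics.QuantumFieldTheory.Luscher2010
open Literature.Probability.LatticeModels
open Literature.Analysis.Complex
open scoped Matrix Matrix.Norms.Frobenius ContDiff

namespace Summit.Ventures.LatticeQCDFlow.TrivializingMaps

section AnyGroup

variable {d L N : ℕ} [NeZero L] {G : Type*} [Group G] [TopologicalSpace G] [IsTopologicalGroup G]
  [CompactSpace G] [MeasurableSpace G] [BorelSpace G] [SecondCountableTopology G]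
  (ρ : G →* Matrix (Fin N) (Fin N) ℂ)

/-! ## §1 The dictionary `ψ = cgf(-S_W)`, `ψ″(t) = Var_{μ_t}(S_W)` -/

/-- Every real `t` is interior to the domain of the MGF of `-S_W` (the action is bounded). [folklore] -/
theorem mem_interior_integrableExpSet_neg_wilsonAction (hρ : Continuous ρ) (t : ℝ) :
    t ∈ interior (integrableExpSet (fun U => -wilsonAction ρ U) (trivialMeasure G d L)) := by
  have huniv : integrableExpSet (fun U => -wilsonAction ρ U) (trivialMeasure G d L) = Set.univ :=
    Set.eq_univ_of_forall fun s => integrable_trivialMeasure_of_continuous_group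
      (Real.continuous_exp.comp (continuous_const.mul (continuous_wilsonAction_of_continuous ρ hρ).neg))
  rw [huniv, interior_univ]; exact Set.mem_univ t

/-- `μ_t = wilsonMeasure ρ t` is `D[U]` tilted by `t·(-S_W)` (the Literature's
`wilsonMeasure_eq_tilted_pi`). [folklore] -/
theorem wilsonMeasure_eq_tilted_neg (hρ : Continuous ρ) (t : ℝ) :
    wilsonMeasure (d := d) (L := L) ρ t =
      (trivialMeasure G d L).tilted fun U => t * (-wilsonAction ρ U) := by
  rw [Literature.MathematicalPhysics.QuantumLattice.wilsonMeasure_eq_tilted_pi ρ hρ t]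
  unfold trivialMeasure
  congr 1
  funext U
  ring

/-- **`ψ″(t) = Var_{μ_t}(S_W^ρ)`** with `ψ = cgf(-S_W^ρ)` under `D[U]`. [folklore] -/
theorem iteratedDeriv_two_cgf_eq_variance_wilsonMeasure (hρ : Continuous ρ) (t : ℝ) :
    iteratedDeriv 2 (cgf (fun U => -wilsonAction ρ U) (trivialMeasure G d L)) t =
      variance (wilsonAction (d := d) (L := L) ρ) (wilsonMeasure (d := d) (L := L) ρ t) := by
  rw [← variance_tilted_mul (mem_interior_integrableExpSet_neg_wilsonAction ρ hρ t),
    ← wilsonMeasure_eq_tilted_neg ρ hρ t, variance_fun_neg]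

/-- `ψ = cgf(-S_W)` is real-analytic on `ℝ`. [folklore] -/
theorem cgf_neg_wilsonAction_analyticOnNhd (hρ : Continuous ρ) :
    AnalyticOnNhd ℝ (cgf (fun U => -wilsonAction ρ U) (trivialMeasure G d L)) Set.univ := fun t _ =>
  analyticAt_cgf (mem_interior_integrableExpSet_neg_wilsonAction ρ hρ t)

/-! ## §2 The holomorphic logarithm on the Kotecký–Preiss disc and its restriction to the real axis -/

/-- **Package, every compact gauge group**: with `r = 1/(4e·max(1,2N)·(3^d d²+1)²)` and `F` the
Kotecký–Preiss logarithm of the torus plaquette system (all genuine plaquettes on): `F` is holomorphic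
on `|s| < r`, `‖F‖ ≤ #plaq` there, and `Re F(t) = cgf(-S_W)(t)` for real `|t| < r`. [ours] -/
theorem logZ_kp_package_anyGroup (hρ : Continuous ρ) (hρu : ∀ g, ρ g ∈ Matrix.unitaryGroup (Fin N) ℂ) :
    let r : ℝ := 1 / (4 * Real.exp 1 * max 1 (2 * (N : ℝ)) * ((3 : ℝ) ^ d * (d : ℝ) ^ 2 + 1) ^ 2)
    let F : ℂ → ℂ := fun β => pertLogZ (zdHaar d G) ((torusSystem ρ L).weight β)
      (torusSystem ρ L).Adj (torusGenuine d L)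
    DifferentiableOn ℂ F (ball 0 r) ∧ (∀ β ∈ ball (0 : ℂ) r, ‖F β‖ ≤ Fintype.card (Plaquette d L)) ∧
      (∀ t : ℝ, |t| < r → (F t).re = cgf (fun U => -wilsonAction ρ U) (trivialMeasure G d L) t) := by
  classical
  intro r F
  have hR := torusSystem_regular (d := d) (L := L) (G := G) ρ hρ
  set M' : ℝ := max 1 (2 * (N : ℝ)) with hM'
  set K : ℝ := ((3 : ℝ) ^ d * (d : ℝ) ^ 2 + 1) ^ 2 with hK
  have hM'1 : 1 ≤ M' := le_max_left _ _
  have hK1 : 1 ≤ K := by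
    rw [hK]; nlinarith [show (0 : ℝ) ≤ (3 : ℝ) ^ d * (d : ℝ) ^ 2 by positivity]
  have he1 : 1 ≤ Real.exp 1 := Real.one_le_exp zero_le_one
  have hMle : costBound ρ ≤ M' := costBound_le_of_unitary ρ hρu
  have hM0 : 0 < costBound ρ := costBound_pos ρ
  have hDK : ((Plaq.degBound d : ℝ) + 1) ^ 2 = K := by rw [cast_degBound]
  have hr : r = 1 / (4 * Real.exp 1 * M' * K) := rfl
  -- KP conditions at radius `r`
  have h1 : r * costBound ρ ≤ 1 := by
    rw [hr, div_mul_eq_mul_div, one_mul, div_le_one (by positivity)]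
    have heK : 1 ≤ Real.exp 1 * K := one_le_mul_of_one_le_of_one_le he1 hK1
    nlinarith
  have h2 : Real.exp 1 * (2 * costBound ρ * r) * ((Plaq.degBound d : ℝ) + 1) ^ 2 ≤ 1 / 2 := by
    rw [hDK, hr]
    calc Real.exp 1 * (2 * costBound ρ * (1 / (4 * Real.exp 1 * M' * K))) * K
        ≤ Real.exp 1 * (2 * M' * (1 / (4 * Real.exp 1 * M' * K))) * K := by gcongr
      _ = 1 / 2 := by field_simp; ring
  have hball : ∀ β ∈ ball (0 : ℂ) r, ‖β‖ * costBound ρ ≤ 1 ∧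
      Real.exp 1 * (2 * costBound ρ * ‖β‖) * ((Plaq.degBound d : ℝ) + 1) ^ 2 ≤ 1 / 2 := by
    intro β hβ
    rw [Metric.mem_ball, dist_zero_right] at hβ
    exact ⟨le_trans (by gcongr) h1, le_trans (by gcongr) h2⟩
  refine ⟨PlaqSystem.differentiableOn_pertLogZ hR h1 h2 _, fun β hβ => ?_, fun t ht => ?_⟩
  · have h := PlaqSystem.norm_pertLogZ_le_card hR (hball β hβ).1 (hball β hβ).2 (torusGenuine d L)
    rw [card_torusGenuine] at h
    exact h
  · have htball : (t : ℂ) ∈ ball (0 : ℂ) r := by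
      rw [Metric.mem_ball, dist_zero_right, Complex.norm_real, Real.norm_eq_abs]; exact ht
    have hint : Integrable (fun U => Real.exp (t * (-wilsonAction ρ U))) (trivialMeasure G d L) :=
      integrable_trivialMeasure_of_continuous_group
        (Real.continuous_exp.comp (continuous_const.mul (continuous_wilsonAction_of_continuous ρ hρ).neg))
    haveI : IsProbabilityMeasure (trivialMeasure G d L) := by unfold trivialMeasure; infer_instance
    have hpos : 0 < mgf (fun U => -wilsonAction ρ U) (trivialMeasure G d L) t := mgf_pos hint
    show (F (t : ℂ)).re = _
    rw [PlaqSystem.re_pertLogZ_eq_log_norm_partZ hR (hball _ htball).1 (hball _ htball).2,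
      torusSystem_partZ_genuine_eq_complexMGF ρ hρ, complexMGF_ofReal, Complex.norm_real,
      Real.norm_eq_abs, abs_of_pos hpos]
    rfl

/-- **`Var_t(S_W^ρ) = Re F″(t)` for real `|t| < r`** (`F` as in `logZ_kp_package_anyGroup`). [ours] -/
theorem variance_eq_re_iteratedDeriv_two (hρ : Continuous ρ)
    (hρu : ∀ g, ρ g ∈ Matrix.unitaryGroup (Fin N) ℂ) (t : ℝ)
    (ht : |t| < 1 / (4 * Real.exp 1 * max 1 (2 * (N : ℝ)) * ((3 : ℝ) ^ d * (d : ℝ) ^ 2 + 1) ^ 2)) :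
    variance (wilsonAction (d := d) (L := L) ρ) (wilsonMeasure (d := d) (L := L) ρ t) =
      (iteratedDeriv 2 (fun β : ℂ => pertLogZ (zdHaar d G) ((torusSystem ρ L).weight β)
        (torusSystem ρ L).Adj (torusGenuine d L)) (t : ℂ)).re := by
  classical
  set r : ℝ := 1 / (4 * Real.exp 1 * max 1 (2 * (N : ℝ)) * ((3 : ℝ) ^ d * (d : ℝ) ^ 2 + 1) ^ 2)
    with hr
  set F : ℂ → ℂ := fun β => pertLogZ (zdHaar d G) ((torusSystem ρ L).weight β)
    (torusSystem ρ L).Adj (torusGenuine d L) with hF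
  set ψ := cgf (fun U => -wilsonAction ρ U) (trivialMeasure G d L) with hψ
  obtain ⟨hFd, -, hFre⟩ := logZ_kp_package_anyGroup (d := d) (L := L) ρ hρ hρu
  have hF1d : DifferentiableOn ℂ (deriv F) (ball 0 r) := hFd.deriv isOpen_ball
  -- real points of the disc
  have hmem : ∀ s : ℝ, |s| < r → (s : ℂ) ∈ ball (0 : ℂ) r := fun s hs => by
    rw [Metric.mem_ball, dist_zero_right, Complex.norm_real, Real.norm_eq_abs]; exact hs
  have hI : IsOpen {s : ℝ | |s| < r} := isOpen_lt continuous_abs continuous_const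
  -- `ψ₁ := Re F ∘ ofReal` and its first two derivatives on the interval
  have hd1 : ∀ s : ℝ, |s| < r → HasDerivAt (fun x : ℝ => (F x).re) (deriv F s).re s := fun s hs =>
    ((hFd.differentiableAt (isOpen_ball.mem_nhds (hmem s hs))).hasDerivAt).real_of_complex
  have hd2 : ∀ s : ℝ, |s| < r →
      HasDerivAt (fun x : ℝ => (deriv F x).re) (deriv (deriv F) s).re s := fun s hs =>
    ((hF1d.differentiableAt (isOpen_ball.mem_nhds (hmem s hs))).hasDerivAt).real_of_complex
  -- `ψ = Re F` near `t`, hence equal first derivatives near `t`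
  have hψeq : ∀ s : ℝ, |s| < r → ψ s = (F s).re := fun s hs => (hFre s hs).symm
  have hderiv1 : ∀ s : ℝ, |s| < r → deriv ψ s = (deriv F s).re := by
    intro s hs
    have hev : ψ =ᶠ[𝓝 s] fun x : ℝ => (F x).re :=
      Filter.eventually_of_mem (hI.mem_nhds hs) fun x hx => hψeq x hx
    rw [hev.deriv_eq, (hd1 s hs).deriv]
  have hev2 : deriv ψ =ᶠ[𝓝 t] fun x : ℝ => (deriv F x).re :=
    Filter.eventually_of_mem (hI.mem_nhds ht) fun x hx => hderiv1 x hx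
  rw [← iteratedDeriv_two_cgf_eq_variance_wilsonMeasure ρ hρ t, iteratedDeriv_succ, iteratedDeriv_one,
    ← hψ, hev2.deriv_eq, (hd2 t ht).deriv, iteratedDeriv_succ, iteratedDeriv_one]

/-! ## §3 Volume-uniform strong-coupling bounds for every compact gauge group -/

/-- **`|Var_x(S_W^ρ) − #plaq·Var_Haar(Re tr ρ)| ≤ 256·#plaq·|x|/r³`** for every `L ≥ 2` and
`|x| < r/4`, `r = 1/(4e·max(1,2N)·(3^d d²+1)²)`. [ours] -/
theorem wilson_variance_sub_le_anyGroup (hρ : Continuous ρ)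
    (hρu : ∀ g, ρ g ∈ Matrix.unitaryGroup (Fin N) ℂ) (hL : 2 ≤ L) (x : ℝ)
    (hx : |x| < 1 / (4 * Real.exp 1 * max 1 (2 * (N : ℝ)) * ((3 : ℝ) ^ d * (d : ℝ) ^ 2 + 1) ^ 2) / 4) :
    |variance (wilsonAction (d := d) (L := L) ρ) (wilsonMeasure (d := d) (L := L) ρ x) -
        Fintype.card (Plaquette d L) * variance (fun g => (ρ g).trace.re) (haarProbability G)| ≤
      256 * Fintype.card (Plaquette d L) * |x| /
        (1 / (4 * Real.exp 1 * max 1 (2 * (N : ℝ)) * ((3 : ℝ) ^ d * (d : ℝ) ^ 2 + 1) ^ 2)) ^ 3 := by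
  classical
  set r : ℝ := 1 / (4 * Real.exp 1 * max 1 (2 * (N : ℝ)) * ((3 : ℝ) ^ d * (d : ℝ) ^ 2 + 1) ^ 2)
    with hr
  set P : ℝ := (Fintype.card (Plaquette d L) : ℝ) with hP
  set F : ℂ → ℂ := fun β => pertLogZ (zdHaar d G) ((torusSystem ρ L).weight β)
    (torusSystem ρ L).Adj (torusGenuine d L) with hF
  obtain ⟨hFd, hFb, -⟩ := logZ_kp_package_anyGroup (d := d) (L := L) ρ hρ hρu
  have hr0 : 0 < r := kpRadiusGroup_pos d N
  have hP0 : 0 ≤ P := by rw [hP]; positivity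
  have hF2d : DifferentiableOn ℂ (iteratedDeriv 2 F) (ball 0 r) := by
    rw [iteratedDeriv_succ, iteratedDeriv_one]; exact (hFd.deriv isOpen_ball).deriv isOpen_ball
  have hF2b : ∀ z ∈ ball (0 : ℂ) (r / 2), ‖iteratedDeriv 2 F z‖ ≤ 32 * P / r ^ 2 := by
    intro z hz
    rw [Metric.mem_ball, dist_zero_right] at hz
    have hsub : ball z (r / 2) ⊆ ball 0 r := by
      intro u hu
      rw [Metric.mem_ball, dist_zero_right]
      rw [Metric.mem_ball] at hu
      calc ‖u‖ = ‖(u - z) + z‖ := by rw [sub_add_cancel]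
        _ ≤ ‖u - z‖ + ‖z‖ := norm_add_le _ _
        _ < r / 2 + r / 2 := by rw [← dist_eq_norm]; exact add_lt_add hu hz
        _ = r := by ring
    have h := norm_iteratedDeriv_le_of_forall_mem_ball (f := F) (c := z) (R := r / 2) (M := P)
      (by positivity) (hFd.mono hsub) (fun u hu => hFb u (hsub hu)) 2
    refine h.trans (le_of_eq ?_)
    simp only [Nat.factorial_two, Nat.cast_ofNat]
    field_simp
    ring
  have hxball : (x : ℂ) ∈ ball (0 : ℂ) (r / 2 / 2) := by
    rw [Metric.mem_ball, dist_zero_right, Complex.norm_real, Real.norm_eq_abs]; linarith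
  have h0ball : (0 : ℂ) ∈ ball (0 : ℂ) (r / 2 / 2) := mem_ball_self (by positivity)
  have hlip := norm_sub_le_mul_of_forall_mem_ball (f := iteratedDeriv 2 F) (c := 0) (R := r / 2)
    (M := 32 * P / r ^ 2) (by positivity) (hF2d.mono (ball_subset_ball (by linarith))) hF2b
    hxball h0ball
  -- the two variances as real parts
  have hx' : |x| < r := by linarith
  have hVx := variance_eq_re_iteratedDeriv_two (d := d) (L := L) ρ hρ hρu x hx'
  have hV0 := variance_eq_re_iteratedDeriv_two (d := d) (L := L) ρ hρ hρu 0 (by rw [abs_zero]; exact hr0)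
  rw [Complex.ofReal_zero] at hV0
  have hvar0 : variance (wilsonAction (d := d) (L := L) ρ) (wilsonMeasure (d := d) (L := L) ρ 0) =
      P * variance (fun g => (ρ g).trace.re) (haarProbability G) := by
    rw [wilsonMeasure_zero_eq_trivialMeasure, hP]
    exact variance_wilsonAction_eq_card_mul ρ hρ hL
  rw [← hvar0, hVx, hV0, ← Complex.sub_re]
  refine (Complex.abs_re_le_norm _).trans (hlip.trans (le_of_eq ?_))
  rw [sub_zero, Complex.norm_real, Real.norm_eq_abs]
  have hr0' : r ≠ 0 := hr0.ne'
  field_simp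
  ring

/-- **`Var_x(S_W^ρ) ≤ 32·#plaq/r²` for `|x| < r/2`, every `L`.** [ours] -/
theorem wilson_variance_le_anyGroup (hρ : Continuous ρ) (hρu : ∀ g, ρ g ∈ Matrix.unitaryGroup (Fin N) ℂ)
    (x : ℝ)
    (hx : |x| < 1 / (4 * Real.exp 1 * max 1 (2 * (N : ℝ)) * ((3 : ℝ) ^ d * (d : ℝ) ^ 2 + 1) ^ 2) / 2) :
    variance (wilsonAction (d := d) (L := L) ρ) (wilsonMeasure (d := d) (L := L) ρ x) ≤
      32 * Fintype.card (Plaquette d L) /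
        (1 / (4 * Real.exp 1 * max 1 (2 * (N : ℝ)) * ((3 : ℝ) ^ d * (d : ℝ) ^ 2 + 1) ^ 2)) ^ 2 := by
  classical
  set r : ℝ := 1 / (4 * Real.exp 1 * max 1 (2 * (N : ℝ)) * ((3 : ℝ) ^ d * (d : ℝ) ^ 2 + 1) ^ 2)
    with hr
  set P : ℝ := (Fintype.card (Plaquette d L) : ℝ) with hP
  set F : ℂ → ℂ := fun β => pertLogZ (zdHaar d G) ((torusSystem ρ L).weight β)
    (torusSystem ρ L).Adj (torusGenuine d L) with hF
  obtain ⟨hFd, hFb, -⟩ := logZ_kp_package_anyGroup (d := d) (L := L) ρ hρ hρu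
  have hr0 : 0 < r := kpRadiusGroup_pos d N
  have hxr : |x| < r := by linarith
  have hsub : ball (x : ℂ) (r / 2) ⊆ ball 0 r := by
    intro u hu
    rw [Metric.mem_ball, dist_zero_right]
    rw [Metric.mem_ball, dist_eq_norm] at hu
    have hxn : ‖(x : ℂ)‖ < r / 2 := by rw [Complex.norm_real, Real.norm_eq_abs]; exact hx
    calc ‖u‖ = ‖(u - x) + x‖ := by rw [sub_add_cancel]
      _ ≤ ‖u - (x : ℂ)‖ + ‖(x : ℂ)‖ := norm_add_le _ _
      _ < r / 2 + r / 2 := add_lt_add hu hxn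
      _ = r := by ring
  have h := norm_iteratedDeriv_le_of_forall_mem_ball (f := F) (c := (x : ℂ)) (R := r / 2) (M := P)
    (by positivity) (hFd.mono hsub) (fun u hu => hFb u (hsub hu)) 2
  rw [variance_eq_re_iteratedDeriv_two (d := d) (L := L) ρ hρ hρu x hxr]
  refine (Complex.re_le_norm _).trans (h.trans (le_of_eq ?_))
  simp only [Nat.factorial_two, Nat.cast_ofNat]
  field_simp
  ring

/-- **A FISHER ZERO WITHIN `8N/v_ρ` OF EVERY STRONG-COUPLING POINT, EVERY COMPACT GAUGE GROUP**: if
`v_ρ = Var_Haar(Re tr ρ) > 0`, `d ≥ 2`, `L ≥ 2` and `|x| ≤ min (r/8) (v_ρ r³/512)`, then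
`Z_L(s₀) = 0` for some `|s₀ − x| ≤ 8N/v_ρ`. [ours] -/
theorem wilson_exists_fisherZero_near_anyGroup (hρ : Continuous ρ)
    (hρu : ∀ g, ρ g ∈ Matrix.unitaryGroup (Fin N) ℂ) (hd : 2 ≤ d) (hL : 2 ≤ L)
    (hv : 0 < variance (fun g => (ρ g).trace.re) (haarProbability G)) (x : ℝ)
    (hx : |x| ≤ min (1 / (4 * Real.exp 1 * max 1 (2 * (N : ℝ)) * ((3 : ℝ) ^ d * (d : ℝ) ^ 2 + 1) ^ 2) / 8)
      (variance (fun g => (ρ g).trace.re) (haarProbability G) *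
        (1 / (4 * Real.exp 1 * max 1 (2 * (N : ℝ)) * ((3 : ℝ) ^ d * (d : ℝ) ^ 2 + 1) ^ 2)) ^ 3 / 512)) :
    ∃ s₀ : ℂ, ‖s₀ - x‖ ≤ 8 * N / variance (fun g => (ρ g).trace.re) (haarProbability G) ∧
      complexMGF (fun U => -wilsonAction ρ U) (trivialMeasure G d L) s₀ = 0 := by
  set r : ℝ := 1 / (4 * Real.exp 1 * max 1 (2 * (N : ℝ)) * ((3 : ℝ) ^ d * (d : ℝ) ^ 2 + 1) ^ 2)
    with hr
  set v := variance (fun g => (ρ g).trace.re) (haarProbability G) with hvdef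
  set P : ℝ := (Fintype.card (Plaquette d L) : ℝ) with hP
  set D := trivialMeasure G d L with hD
  haveI : IsProbabilityMeasure D := by rw [hD]; unfold trivialMeasure; infer_instance
  have hr0 : 0 < r := kpRadiusGroup_pos d N
  have hP1 : 1 ≤ P := by rw [hP]; exact_mod_cast WilsonPinching.one_le_card_plaquette hd
  have hx1 : |x| ≤ r / 8 := hx.trans (min_le_left _ _)
  have hx2 : |x| ≤ v * r ^ 3 / 512 := hx.trans (min_le_right _ _)
  -- the variance floor `v P / 2`
  have hdiff := wilson_variance_sub_le_anyGroup (d := d) (L := L) ρ hρ hρu hL x (by linarith)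
  rw [← hr, ← hP, ← hvdef] at hdiff
  have hfloor : v * P / 2 ≤ variance (wilsonAction (d := d) (L := L) ρ)
      (wilsonMeasure (d := d) (L := L) ρ x) := by
    have h' := (abs_sub_le_iff.1 hdiff).2
    have hkey : 256 * P * |x| / r ^ 3 ≤ v * P / 2 := by
      rw [div_le_iff₀ (by positivity)]
      have : 256 * |x| ≤ v * r ^ 3 / 2 := by linarith
      nlinarith
    linarith
  have hvarpos : 0 < variance (wilsonAction (d := d) (L := L) ρ) (wilsonMeasure (d := d) (L := L) ρ x) :=
    lt_of_lt_of_le (by positivity) hfloor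
  -- the abstract tilted-measure radius law
  have hm : AEMeasurable (fun U => -wilsonAction ρ U) D :=
    (WilsonRP.measurable_wilsonAction ρ hρ).neg.aemeasurable
  have hb : ∀ᵐ U ∂D, |(-wilsonAction ρ U) - (-((N : ℝ) * P))| ≤ (N : ℝ) * P :=
    ae_of_all _ fun U => by
      have h0 := WilsonPinching.wilsonAction_nonneg ρ hρ U
      have h1 := WilsonPinching.wilsonAction_le ρ hρ U
      rw [abs_le, hP]
      constructor <;> linarith
  have hVt : variance (fun U => -wilsonAction ρ U) (D.tilted fun U => x * (-wilsonAction ρ U)) =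
      variance (wilsonAction (d := d) (L := L) ρ) (wilsonMeasure (d := d) (L := L) ρ x) := by
    rw [hD, ← wilsonMeasure_eq_tilted_neg ρ hρ x, variance_fun_neg]
  have hvar' : 0 < variance (fun U => -wilsonAction ρ U) (D.tilted fun U => x * (-wilsonAction ρ U)) := by
    rw [hVt]; exact hvarpos
  obtain ⟨s₀, hs₀, hz⟩ := exists_zero_near_norm_le_of_variance_tilted_pos hm hb x hvar'
  refine ⟨s₀, hs₀.trans ?_, hz⟩
  rw [hVt, abs_of_nonneg (by positivity), div_le_div_iff₀ hvarpos hv]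
  nlinarith

end AnyGroup

/-! ## §4 `U(1)` -/

section U1

open Literature.MathematicalPhysics.QuantumLattice (u1Rep u1Rep_apply continuous_u1Rep
  u1Rep_mem_unitaryGroup)

variable {d L : ℕ} [NeZero L] [MeasurableSpace Circle] [BorelSpace Circle]

/-- **`U(1)`: `|Var_x(S_W) − #plaq/2| ≤ 256·#plaq·|x|/r³`** for `L ≥ 2`, `|x| < r/4`,
`r = 1/(8e(3^d d²+1)²)`: the specific heat per plaquette is `½ + O(|x|)` uniformly in the volume. [ours] -/
theorem u1_variance_sub_le (hL : 2 ≤ L) (x : ℝ)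
    (hx : |x| < 1 / (8 * Real.exp 1 * ((3 : ℝ) ^ d * (d : ℝ) ^ 2 + 1) ^ 2) / 4) :
    |variance (wilsonAction (d := d) (L := L) u1Rep) (wilsonMeasure (d := d) (L := L) u1Rep x) -
        Fintype.card (Plaquette d L) / 2| ≤
      256 * Fintype.card (Plaquette d L) * |x| / (1 / (8 * Real.exp 1 * ((3 : ℝ) ^ d * (d : ℝ) ^ 2 + 1) ^ 2)) ^ 3 := by
  have hmax : max 1 (2 * ((1 : ℕ) : ℝ)) = 2 := by norm_num
  have hr : 1 / (4 * Real.exp 1 * max 1 (2 * ((1 : ℕ) : ℝ)) * ((3 : ℝ) ^ d * (d : ℝ) ^ 2 + 1) ^ 2) =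
      1 / (8 * Real.exp 1 * ((3 : ℝ) ^ d * (d : ℝ) ^ 2 + 1) ^ 2) := by rw [hmax]; ring
  have h := wilson_variance_sub_le_anyGroup (d := d) (L := L) u1Rep continuous_u1Rep
    u1Rep_mem_unitaryGroup hL x (by rw [hr]; exact hx)
  rw [hr, variance_re_haar_circle] at h
  convert h using 2
  ring

/-- **`U(1)`: A FISHER ZERO WITHIN `16` OF EVERY STRONG-COUPLING POINT, EVERY VOLUME**: `d ≥ 2`, `L ≥ 2`,
`|x| ≤ min (r/8) (r³/1024)`, `r = 1/(8e(3^d d²+1)²)` `⇒` `Z_L(s₀) = 0` for some `|s₀ − x| ≤ 16`. [ours] -/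
theorem u1_exists_fisherZero_near (hd : 2 ≤ d) (hL : 2 ≤ L) (x : ℝ)
    (hx : |x| ≤ min (1 / (8 * Real.exp 1 * ((3 : ℝ) ^ d * (d : ℝ) ^ 2 + 1) ^ 2) / 8)
      ((1 / (8 * Real.exp 1 * ((3 : ℝ) ^ d * (d : ℝ) ^ 2 + 1) ^ 2)) ^ 3 / 1024)) :
    ∃ s₀ : ℂ, ‖s₀ - x‖ ≤ 16 ∧
      complexMGF (fun U => -wilsonAction u1Rep U) (trivialMeasure Circle d L) s₀ = 0 := by
  have hmax : max 1 (2 * ((1 : ℕ) : ℝ)) = 2 := by norm_num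
  have hr : 1 / (4 * Real.exp 1 * max 1 (2 * ((1 : ℕ) : ℝ)) * ((3 : ℝ) ^ d * (d : ℝ) ^ 2 + 1) ^ 2) =
      1 / (8 * Real.exp 1 * ((3 : ℝ) ^ d * (d : ℝ) ^ 2 + 1) ^ 2) := by rw [hmax]; ring
  have hv : 0 < variance (fun z : Circle => ((u1Rep z).trace).re) (haarProbability Circle) := by
    rw [variance_re_haar_circle]; norm_num
  obtain ⟨s₀, hs₀, hz⟩ := wilson_exists_fisherZero_near_anyGroup (d := d) (L := L) u1Rep
    continuous_u1Rep u1Rep_mem_unitaryGroup hd hL hv x (by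
      rw [hr, variance_re_haar_circle]
      have h1024 : (1 / (8 * Real.exp 1 * ((3 : ℝ) ^ d * (d : ℝ) ^ 2 + 1) ^ 2)) ^ 3 / 1024 =
          1 / 2 * (1 / (8 * Real.exp 1 * ((3 : ℝ) ^ d * (d : ℝ) ^ 2 + 1) ^ 2)) ^ 3 / 512 := by ring
      rw [← h1024]; exact hx)
  refine ⟨s₀, ?_, hz⟩
  rw [variance_re_haar_circle] at hs₀
  norm_num at hs₀
  exact hs₀

end U1

end Summit.Ventures.LatticeQCDFlow.TrivializingMaps
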